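import Summits.RiemannHypothesis.RiemannHypothesis.Theorems.LaplaceLoophole.Negative.LaplaceLoopholeThetaLipschitz

/-!
# RiemannHypothesis / UniversalFactor — kernel certificate: the sign of the residue series `Re Φ_ℂ(iy)`
on whole cells (negative-side support for crux `LaplaceLoophole`, item stmt-RiemannHypothesis-2575)

Refuter file (compute-scan seat `lscan-RiemannHypothesis-2575`).  `LaplaceLoopholeThetaLipschitz.lean`
reduces the sign of `Re Φ_ℂ(iy) = Re Σ_{m≥1} s_m(y)` on a cell `[y₁, y₂] ⊆ [0, π/8)` to finitely many
inequalities at the midpoint (`UniversalFactor.PhiICert.re_tsum_pos_on_cell` / `re_tsum_neg_on_cell`: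
a lower bound `c₀ ≤ cos 4t` on the cell, the tail condition `π c₀ (N+1) ≥ 8`, a Lipschitz constant
`D ≥ Σ_{m≤N} dco(m) e^{−πm²c₀}` and a bound `S` for the partial sum at the midpoint with
`10⁻⁷ + D(y₂−y₁)/2 < |S|`).  This file makes those hypotheses KERNEL-DECIDABLE:

* `cellCheck pos N k₁ k₂` — for the cell `[k₁/10⁵, k₂/10⁵]`: `c₀ :=` the lower end of the fixed-point
  enclosure of `cos(4y₂) = Re e^{4iy₂}` (`CB.expI`), `D :=` the upper end of the enclosure of
  `Σ_{m≤N} dco(m) e^{−πm²c₀}` (`expSq`, `FI.pi`), `S :=` the lower/upper end of `Re Σ_{m≤N} s_m(mid)`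
  (`sumCB12`, the `sumCB` of `LaplaceLoopholeThetaCertificate.lean` with 12 squarings), and the three inequalities in exact rational
  arithmetic; `cellsCheck` chains consecutive cells of a breakpoint list;
* `cellCheck_sound`, `cellsCheck_sound` — a passing check gives the sign of `Re Σ_{m≥1} s_m(y)` for every
  real `y` of the cell / of the union of the cells (monotonicity of `cos` on `[0, π]` carries `c₀` from
  the right endpoint to the whole cell).

* `cellsCheck_posCells`, `re_tsum_pos_wide` — the compiled positive window: `Re Φ_ℂ(iy) > 0` for
  `0 ≤ y ≤ 0.3188` (18 cells, `decide +kernel`), i.e. below the residue zero `a₀ = 0.31941502680…`; above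
  `a₀` the wide window is closed by one-point Laguerre certificates instead (`LaplaceLoopholeWideOsa.lean`),
  so no negative cells are compiled.
-/

noncomputable section

set_option linter.dupNamespace false

namespace Summit.RiemannHypothesis.RiemannHypothesis.Theorems

open Literature.Analysis.ValidatedNumerics.Numerics
open Complex Real Finset Set

namespace UniversalFactor.PhiICert

/-! ## The checker (computable) -/

section Checker

/-- Enclosure of `dco(m) = 8π³m⁶ + 30π²m⁴ + 15πm²` from enclosures of `π, π², π³`. [folklore] -/
def dcoFI (p1 p2 p3 : FI) (m : ℕ) : FI :=
  ((p3.mulInt (8 * (m : ℤ) ^ 6)).add (p2.mulInt (30 * (m : ℤ) ^ 4))).add (p1.mulInt (15 * (m : ℤ) ^ 2))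

/-- Enclosure of `Σ_{m=1}^{n} dco(m) e^{−π m² c}` for `c ∈ C0`. [folklore] -/
def dsumFI (p1 p2 p3 C0 : FI) : ℕ → Option FI
  | 0 => some (FI.ofInt 0)
  | n + 1 =>
    match dsumFI p1 p2 p3 C0 n, expSq ((p1.mul C0).mulInt (-(((n + 1 : ℕ) : ℤ) ^ 2))) 12 with
    | some s, some e => some (s.add ((dcoFI p1 p2 p3 (n + 1)).mul e))
    | _, _ => none

/-- `termCB` of `LaplaceLoopholeThetaCertificate.lean` with 12 instead of 8 squarings in the Gaussian
factor `e^{−πm²cos 4y}` (so that `πm²cos 4y ≤ 4096`, i.e. all `m ≤ 36` at every `y`; the original is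
limited to `πm² cos 4y ≤ 256`, which excludes `m = 12` for `y < 0.242`). [folklore] -/
def termCB12 (D : Data) (m : ℕ) : Option CB :=
  let poly := ((D.A.mulFI D.pi2).mulInt (2 * (m : ℤ) ^ 4)).sub ((D.B.mulFI D.piI).mulInt (3 * (m : ℤ) ^ 2))
  match expSq ((D.piI.mul D.E.re).mulInt (-((m : ℤ) ^ 2))) 12 with
  | none => none
  | some g =>
    match CB.expI ((D.piI.mul D.E.im).mulInt (-((m : ℤ) ^ 2))) with
    | none => none
    | some h => some ((poly.mulFI g).mul h)

/-- Enclosure of `Σ_{m=1}^{N} s_m(y)` with `termCB12`. [folklore] -/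
def sumCB12 (D : Data) : ℕ → Option CB
  | 0 => some (CB.ofInt 0)
  | n + 1 =>
    match sumCB12 D n, termCB12 D (n + 1) with
    | some s, some t => some (s.add t)
    | _, _ => none

/-- Scale of the cell breakpoints: `y = k / 10⁵`. [folklore] -/
def KD : ℕ := 100000

/-- **The core cell check on rational data** (`y₂` = right endpoint, `m` = midpoint, `w` = half-width
of the cell; `N` terms, `N ≥ 12`): `c₀ > 0` the scaled lower end of `Re e^{4iy₂}`,
`8·SC² ≤ π.lo · c₀ · (N+1)`, and `10⁻⁷ + D·w < S.lo` (`pos = true`) resp. `S.hi < −10⁻⁷ − D·w`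
(`pos = false`), `D` the upper end of `Σ_{m≤N} dco(m)e^{−πm²c₀}`, `S` the enclosure of `Re Σ_{m≤N} s_m(m)`.
(The rationals are PARAMETERS so that no proof ever case-splits a `match` on closed numerals.) [folklore] -/
def cellCheckQ (pos : Bool) (N : ℕ) (y₂ m w : ℚ) : Bool :=
  match CB.expI (FI.ofRat (4 * y₂)), mkData m with
  | some E2, some Dt =>
    decide (12 ≤ N ∧ 0 < E2.re.lo ∧ (8 * (SC : ℤ) * SC : ℤ) ≤ FI.pi.lo * E2.re.lo * ((N : ℤ) + 1)) &&
    match dsumFI Dt.piI Dt.pi2 (Dt.pi2.mul Dt.piI) (FI.ofScaled E2.re.lo) N, sumCB12 Dt N with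
    | some DD, some S =>
      if pos then
        decide ((1 : ℚ) / 10 ^ 7 + (max DD.hi 0 : ℤ) / (SC : ℚ) * w < (S.re.lo : ℚ) / SC)
      else
        decide ((S.re.hi : ℚ) / SC < -((1 : ℚ) / 10 ^ 7) - (max DD.hi 0 : ℤ) / (SC : ℚ) * w)
    | _, _ => false
  | _, _ => false

/-- **The cell check.** Cell `[k₁/10⁵, k₂/10⁵]` with `k₁ ≤ k₂ ≤ 3·10⁵/4` (so `4y₂ ≤ 3 < π`):
the core check at `y₂ = k₂/10⁵`, midpoint `(k₁ + k₂)/(2·10⁵)`, half-width `(k₂ − k₁)/(2·10⁵)`. [folklore] -/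
def cellCheck (pos : Bool) (N k₁ k₂ : ℕ) : Bool :=
  decide (k₁ ≤ k₂ ∧ 4 * k₂ ≤ 3 * KD) &&
    cellCheckQ pos N ((k₂ : ℚ) / KD) (((k₁ : ℚ) + k₂) / (2 * KD)) (((k₂ : ℚ) - k₁) / (2 * KD))

/-- Chained cell checks over the consecutive cells `[k₀, k₁], [k₁, k₂], …, [k_{n-1}, k_n]` of a
start point `k₀` and a NON-EMPTY breakpoint list `[k₁, …, k_n]`. [folklore] -/
def cellsCheck (pos : Bool) (N : ℕ) : ℕ → List ℕ → Bool
  | _, [] => false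
  | k₀, [k₁] => cellCheck pos N k₀ k₁
  | k₀, k₁ :: k₂ :: rest => cellCheck pos N k₀ k₁ && cellsCheck pos N k₁ (k₂ :: rest)

end Checker

/-! ## Soundness -/

/-- Soundness of `termCB12` (the proof of `mem_termCB` verbatim). [folklore] -/
theorem mem_termCB12 {y : ℝ} {D : Data} (hA : CB.mem (cexp (9 * (I * y))) D.A)
    (hB : CB.mem (cexp (5 * (I * y))) D.B) (hE : CB.mem (cexp (4 * (I * y))) D.E)
    (hpi : FI.mem π D.piI) (hpi2 : FI.mem (π ^ 2) D.pi2) {m : ℕ} {T : CB} (h : termCB12 D m = some T) :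
    CB.mem (term m y) T := by
  unfold termCB12 at h
  simp only at h
  split at h
  · simp at h
  · rename_i g hg
    split at h
    · simp at h
    · rename_i hh hexp
      simp only [Option.some.injEq] at h
      subst h
      have hpoly : CB.mem (cexp (9 * (I * y)) * ((π ^ 2 : ℝ) : ℂ) * ((2 * (m : ℤ) ^ 4 : ℤ) : ℂ) -
          cexp (5 * (I * y)) * ((π : ℝ) : ℂ) * ((3 * (m : ℤ) ^ 2 : ℤ) : ℂ))
          (((D.A.mulFI D.pi2).mulInt (2 * (m : ℤ) ^ 4)).sub ((D.B.mulFI D.piI).mulInt (3 * (m : ℤ) ^ 2))) :=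
        CB.mem_sub (CB.mem_mulInt (CB.mem_mulFI hA hpi2) (2 * (m : ℤ) ^ 4))
          (CB.mem_mulInt (CB.mem_mulFI hB hpi) (3 * (m : ℤ) ^ 2))
      have hre : FI.mem (Real.cos (4 * y)) D.E.re := by
        have := hE.1
        have e : (cexp (4 * (I * (y : ℂ)))).re = Real.cos (4 * y) := by
          rw [show (4 * (I * (y : ℂ))) = ((4 * y : ℝ) : ℂ) * I by push_cast; ring, Complex.exp_ofReal_mul_I_re]
        rwa [e] at this
      have him : FI.mem (Real.sin (4 * y)) D.E.im := by
        have := hE.2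
        have e : (cexp (4 * (I * (y : ℂ)))).im = Real.sin (4 * y) := by
          rw [show (4 * (I * (y : ℂ))) = ((4 * y : ℝ) : ℂ) * I by push_cast; ring, Complex.exp_ofReal_mul_I_im]
        rwa [e] at this
      have hg' : FI.mem (Real.exp (π * Real.cos (4 * y) * ((-((m : ℤ) ^ 2) : ℤ) : ℝ))) g :=
        mem_expSq hg (FI.mem_mulInt (FI.mem_mul hpi hre) (-((m : ℤ) ^ 2)))
      have hh' : CB.mem (cexp (((π * Real.sin (4 * y) * ((-((m : ℤ) ^ 2) : ℤ) : ℝ) : ℝ) : ℂ) * I)) hh :=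
        CB.mem_expI hexp (FI.mem_mulInt (FI.mem_mul hpi him) (-((m : ℤ) ^ 2)))
      have hall := CB.mem_mul (CB.mem_mulFI hpoly hg') hh'
      have e : term m y = (cexp (9 * (I * y)) * ((π ^ 2 : ℝ) : ℂ) * ((2 * (m : ℤ) ^ 4 : ℤ) : ℂ) -
          cexp (5 * (I * y)) * ((π : ℝ) : ℂ) * ((3 * (m : ℤ) ^ 2 : ℤ) : ℂ)) *
          (Real.exp (π * Real.cos (4 * y) * ((-((m : ℤ) ^ 2) : ℤ) : ℝ)) : ℂ) *
          cexp (((π * Real.sin (4 * y) * ((-((m : ℤ) ^ 2) : ℤ) : ℝ) : ℝ) : ℂ) * I) := by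
        rw [term, cexp_neg_pi_sq_eq, ← mul_assoc]
        congr 1
        push_cast
        ring
      rwa [e]

/-- Soundness of `sumCB12`. [folklore] -/
theorem mem_sumCB12 {y : ℝ} {D : Data} (hA : CB.mem (cexp (9 * (I * y))) D.A)
    (hB : CB.mem (cexp (5 * (I * y))) D.B) (hE : CB.mem (cexp (4 * (I * y))) D.E)
    (hpi : FI.mem π D.piI) (hpi2 : FI.mem (π ^ 2) D.pi2) {N : ℕ} {S : CB} (h : sumCB12 D N = some S) :
    CB.mem (∑ n ∈ Finset.range N, term (n + 1) y) S := by
  induction N generalizing S with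
  | zero =>
    simp only [sumCB12, Option.some.injEq] at h
    subst h
    simpa using CB.mem_ofInt 0
  | succ n ih =>
    simp only [sumCB12] at h
    split at h
    · rename_i s t hs ht
      simp only [Option.some.injEq] at h
      subst h
      rw [Finset.sum_range_succ]
      exact CB.mem_add (ih hs) (mem_termCB12 hA hB hE hpi hpi2 ht)
    · simp at h

/-- Soundness of `dcoFI`. [folklore] -/
theorem mem_dcoFI {p1 p2 p3 : FI} (h1 : FI.mem π p1) (h2 : FI.mem (π ^ 2) p2) (h3 : FI.mem (π ^ 3) p3)
    (m : ℕ) : FI.mem (dco m) (dcoFI p1 p2 p3 m) := by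
  have e : dco m = π ^ 3 * ((8 * (m : ℤ) ^ 6 : ℤ) : ℝ) + π ^ 2 * ((30 * (m : ℤ) ^ 4 : ℤ) : ℝ) +
      π * ((15 * (m : ℤ) ^ 2 : ℤ) : ℝ) := by
    simp only [dco]; push_cast; ring
  rw [e]
  exact FI.mem_add (FI.mem_add (FI.mem_mulInt h3 _) (FI.mem_mulInt h2 _)) (FI.mem_mulInt h1 _)

/-- Soundness of `dsumFI`. [folklore] -/
theorem mem_dsumFI {p1 p2 p3 C0 : FI} (h1 : FI.mem π p1) (h2 : FI.mem (π ^ 2) p2)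
    (h3 : FI.mem (π ^ 3) p3) {c : ℝ} (hc : FI.mem c C0) {n : ℕ} {Dn : FI} (h : dsumFI p1 p2 p3 C0 n = some Dn) :
    FI.mem (∑ j ∈ Finset.range n, dco (j + 1) * Real.exp (-(π * ((j + 1 : ℕ) : ℝ) ^ 2 * c))) Dn := by
  induction n generalizing Dn with
  | zero =>
    simp only [dsumFI, Option.some.injEq] at h
    subst h
    simpa using FI.mem_ofInt 0
  | succ n ih =>
    simp only [dsumFI] at h
    split at h
    · rename_i s e hs he
      simp only [Option.some.injEq] at h
      subst h
      rw [Finset.sum_range_succ]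
      refine FI.mem_add (ih hs) (FI.mem_mul (mem_dcoFI h1 h2 h3 (n + 1)) ?_)
      have hx : FI.mem (π * c * ((-(((n + 1 : ℕ) : ℤ) ^ 2) : ℤ) : ℝ))
          ((p1.mul C0).mulInt (-(((n + 1 : ℕ) : ℤ) ^ 2))) := FI.mem_mulInt (FI.mem_mul h1 hc) _
      have := mem_expSq he hx
      convert this using 2
      push_cast
      ring
    · simp at h

/-- **Soundness of the core check**: the hypotheses of `re_tsum_pos_on_cell` / `re_tsum_neg_on_cell`
as real inequalities. [folklore] -/
theorem cellCheckQ_sound {pos : Bool} {N : ℕ} {y₂ m w : ℚ} (h : cellCheckQ pos N y₂ m w = true) :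
    ∃ (M : ℕ) (c₀ D : ℝ), N = M + 1 ∧ 13 ≤ M + 1 + 1 ∧ 0 < c₀ ∧ c₀ ≤ Real.cos (4 * (y₂ : ℝ)) ∧
      8 ≤ π * c₀ * ((M + 1 + 1 : ℕ) : ℝ) ∧
      (∑ n ∈ Finset.range (M + 1), dco (n + 1) * Real.exp (-(π * ((n + 1 : ℕ) : ℝ) ^ 2 * c₀))) ≤ D ∧
      (pos = true → ∃ S : ℝ, S ≤ (∑ n ∈ Finset.range (M + 1), term (n + 1) (m : ℝ)).re ∧
        1 / 10 ^ 7 + D * (w : ℝ) < S) ∧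
      (pos = false → ∃ S : ℝ, (∑ n ∈ Finset.range (M + 1), term (n + 1) (m : ℝ)).re ≤ S ∧
        S < -(1 / 10 ^ 7) - D * (w : ℝ)) := by
  unfold cellCheckQ at h
  split at h
  rotate_left
  · simp at h
  rename_i E2 Dt hE2 hDt
  rw [Bool.and_eq_true, decide_eq_true_eq] at h
  obtain ⟨⟨hN, hc0, h8⟩, h⟩ := h
  split at h
  rotate_left
  · simp at h
  rename_i DD S hDD hS
  obtain ⟨hA, hB, hE, hpi, hpi2⟩ := mkData_ok hDt
  have hpi3 : FI.mem (π ^ 3) (Dt.pi2.mul Dt.piI) := by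
    simpa [pow_succ] using FI.mem_mul hpi2 hpi
  have hSC := SC_pos
  -- c₀
  set c₀ : ℝ := (E2.re.lo : ℝ) / SC with hc₀def
  have hc₀ : 0 < c₀ := by rw [hc₀def]; exact div_pos (by exact_mod_cast hc0) hSC
  have hcos2 : c₀ ≤ Real.cos (4 * (y₂ : ℝ)) := by
    have hre : FI.mem (Real.cos (4 * (y₂ : ℝ))) E2.re := by
      have := (CB.mem_expI hE2 (FI.mem_ofRat _)).1
      have e : (cexp ((((4 * y₂ : ℚ) : ℝ) : ℂ) * I)).re = Real.cos (4 * (y₂ : ℝ)) := by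
        rw [Complex.exp_ofReal_mul_I_re]; push_cast; ring_nf
      rwa [e] at this
    rw [hc₀def]
    exact FI.lo_div_le hre
  -- N and the tail condition
  obtain ⟨M, rfl⟩ : ∃ M, N = M + 1 := ⟨N - 1, by omega⟩
  have hM : 13 ≤ M + 1 + 1 := by omega
  have h8' : 8 ≤ π * c₀ * ((M + 1 + 1 : ℕ) : ℝ) := by
    have hlo : (FI.pi.lo : ℝ) ≤ π * SC := FI.mem_pi.1
    have h8r : (8 * (SC : ℝ) * SC) ≤ (FI.pi.lo : ℝ) * E2.re.lo * ((M + 1 : ℕ) + 1) := by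
      exact_mod_cast h8
    have hE0 : (0 : ℝ) ≤ E2.re.lo := by exact_mod_cast hc0.le
    have hmul : (FI.pi.lo : ℝ) * E2.re.lo * ((M + 1 : ℕ) + 1) ≤
        π * SC * E2.re.lo * ((M + 1 : ℕ) + 1) := by
      have : (0 : ℝ) ≤ E2.re.lo * ((M + 1 : ℕ) + 1) := by positivity
      nlinarith
    have e : π * c₀ * ((M + 1 + 1 : ℕ) : ℝ) * ((SC : ℝ) * SC) =
        π * SC * E2.re.lo * ((M + 1 : ℕ) + 1) := by
      rw [hc₀def]; field_simp; push_cast; ring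
    have hSS : (0 : ℝ) < (SC : ℝ) * SC := by positivity
    by_contra hlt
    push Not at hlt
    have : π * c₀ * ((M + 1 + 1 : ℕ) : ℝ) * ((SC : ℝ) * SC) < 8 * ((SC : ℝ) * SC) :=
      mul_lt_mul_of_pos_right hlt hSS
    nlinarith
  -- D
  set D : ℝ := ((max DD.hi 0 : ℤ) : ℝ) / SC with hDdef
  have hD : ∑ n ∈ Finset.range (M + 1), dco (n + 1) * Real.exp (-(π * ((n + 1 : ℕ) : ℝ) ^ 2 * c₀)) ≤ D := by
    have hmem := mem_dsumFI hpi hpi2 hpi3 (FI.mem_ofScaled E2.re.lo) hDD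
    have := FI.le_hi_div hmem
    refine this.trans ?_
    rw [hDdef]
    gcongr
    exact_mod_cast le_max_left _ _
  have hmemS := mem_sumCB12 hA hB hE hpi hpi2 hS
  refine ⟨M, c₀, D, rfl, hM, hc₀, hcos2, h8', hD, fun hpos => ?_, fun hneg => ?_⟩
  · subst hpos
    simp only [↓reduceIte, decide_eq_true_eq] at h
    refine ⟨(S.re.lo : ℝ) / SC, FI.lo_div_le hmemS.1, ?_⟩
    have h' := (Rat.cast_lt (K := ℝ)).2 h
    push_cast at h'
    have e : D * (w : ℝ) = max (DD.hi : ℝ) 0 / SC * (w : ℝ) := by rw [hDdef]; push_cast; ring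
    rw [e]; exact h'
  · subst hneg
    simp only [Bool.false_eq_true, ↓reduceIte, decide_eq_true_eq] at h
    refine ⟨(S.re.hi : ℝ) / SC, FI.le_hi_div hmemS.1, ?_⟩
    have h' := (Rat.cast_lt (K := ℝ)).2 h
    push_cast at h'
    have e : D * (w : ℝ) = max (DD.hi : ℝ) 0 / SC * (w : ℝ) := by rw [hDdef]; push_cast; ring
    rw [e]; exact h'

/-- **Soundness of the cell check**: the sign of `Re Σ_{m≥1} s_m(y)` on the whole cell. [folklore] -/
theorem cellCheck_sound {pos : Bool} {N k₁ k₂ : ℕ} (h : cellCheck pos N k₁ k₂ = true) :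
    ∀ y ∈ Icc ((k₁ : ℝ) / KD) ((k₂ : ℝ) / KD),
      (pos = true → 0 < (∑' n : ℕ, term (n + 1) y).re) ∧
      (pos = false → (∑' n : ℕ, term (n + 1) y).re < 0) := by
  rw [cellCheck, Bool.and_eq_true, decide_eq_true_eq] at h
  obtain ⟨⟨hk, hk3⟩, h⟩ := h
  obtain ⟨M, c₀, D, -, hM, hc₀, hcos2, h8', hD, hP, hQ⟩ := cellCheckQ_sound h
  have hKD : (0 : ℝ) < KD := by norm_num [KD]
  set y₁ : ℝ := (k₁ : ℝ) / KD with hy₁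
  set y₂ : ℝ := (k₂ : ℝ) / KD with hy₂
  have ey₂ : (((k₂ : ℚ) / KD : ℚ) : ℝ) = y₂ := by rw [hy₂]; push_cast; rfl
  have em : ((((k₁ : ℚ) + k₂) / (2 * KD) : ℚ) : ℝ) = (y₁ + y₂) / 2 := by
    rw [hy₁, hy₂]; push_cast; field_simp
  have ew : ((((k₂ : ℚ) - k₁) / (2 * KD) : ℚ) : ℝ) = (y₂ - y₁) / 2 := by
    rw [hy₁, hy₂]; push_cast; field_simp
  rw [ey₂] at hcos2
  rw [em, ew] at hP hQ
  have h12 : y₁ ≤ y₂ := div_le_div_of_nonneg_right (by exact_mod_cast hk) hKD.le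
  have hy₂π : 4 * y₂ ≤ π := by
    have : (4 * k₂ : ℝ) ≤ 3 * KD := by exact_mod_cast hk3
    have h' : 4 * y₂ ≤ 3 := by
      rw [hy₂, mul_div_assoc']
      exact (div_le_iff₀ hKD).2 (by linarith)
    linarith [Real.pi_gt_three]
  have hcos : ∀ t ∈ Icc y₁ y₂, c₀ ≤ Real.cos (4 * t) := fun t ht =>
    hcos2.trans (Real.cos_le_cos_of_nonneg_of_le_pi
      (by have : (0 : ℝ) ≤ y₁ := by positivity
          linarith [ht.1]) hy₂π (by linarith [ht.2]))
  intro y hy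
  refine ⟨fun hpos => ?_, fun hneg => ?_⟩
  · obtain ⟨S, hS, hmain⟩ := hP hpos
    exact re_tsum_pos_on_cell hM hc₀ h8' h12 hcos hD hS hmain y hy
  · obtain ⟨S, hS, hmain⟩ := hQ hneg
    exact re_tsum_neg_on_cell hM hc₀ h8' h12 hcos hD hS hmain y hy

/-- **Soundness of the chained check**: the sign on the union `[k₀, k_n]/10⁵`. [folklore] -/
theorem cellsCheck_sound {pos : Bool} {N : ℕ} :
    ∀ (ks : List ℕ) (k₀ : ℕ) (hne : ks ≠ []), cellsCheck pos N k₀ ks = true →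
      ∀ y ∈ Icc ((k₀ : ℝ) / KD) ((ks.getLast hne : ℝ) / KD),
        (pos = true → 0 < (∑' n : ℕ, term (n + 1) y).re) ∧
        (pos = false → (∑' n : ℕ, term (n + 1) y).re < 0)
  | [], _, hne, _ => (hne rfl).elim
  | [k₁], k₀, _, h => by
    simp only [cellsCheck] at h
    simpa only [List.getLast_singleton] using cellCheck_sound h
  | k₁ :: k₂ :: rest, k₀, _, h => by
    simp only [cellsCheck, Bool.and_eq_true] at h
    intro y hy
    by_cases hy1 : y ≤ (k₁ : ℝ) / KD
    · exact cellCheck_sound h.1 y ⟨hy.1, hy1⟩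
    · rw [List.getLast_cons_cons] at hy
      exact cellsCheck_sound (k₂ :: rest) k₁ (List.cons_ne_nil _ _) h.2 y ⟨(not_le.1 hy1).le, hy.2⟩

/-- **Positive sign on a window** `[k₀, k_n]/10⁵` from a passing chained check (`k_n` = the last
breakpoint, supplied explicitly). [folklore] -/
theorem re_tsum_pos_of_cellsCheck {N k₀ kₙ : ℕ} {ks : List ℕ} (h : cellsCheck true N k₀ ks = true)
    (hlast : ks.getLast? = some kₙ) :
    ∀ y ∈ Icc ((k₀ : ℝ) / KD) ((kₙ : ℝ) / KD), 0 < (∑' n : ℕ, term (n + 1) y).re := by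
  have hne : ks ≠ [] := by rintro rfl; simp at hlast
  have hl : ks.getLast hne = kₙ := by
    rw [List.getLast?_eq_some_getLast hne] at hlast
    exact Option.some.inj hlast
  intro y hy
  exact (cellsCheck_sound ks k₀ hne h y (by rwa [hl])).1 rfl

/-- **Negative sign on a window** `[k₀, k_n]/10⁵` from a passing chained check. [folklore] -/
theorem re_tsum_neg_of_cellsCheck {N k₀ kₙ : ℕ} {ks : List ℕ} (h : cellsCheck false N k₀ ks = true)
    (hlast : ks.getLast? = some kₙ) :
    ∀ y ∈ Icc ((k₀ : ℝ) / KD) ((kₙ : ℝ) / KD), (∑' n : ℕ, term (n + 1) y).re < 0 := by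
  have hne : ks ≠ [] := by rintro rfl; simp at hlast
  have hl : ks.getLast hne = kₙ := by
    rw [List.getLast?_eq_some_getLast hne] at hlast
    exact Option.some.inj hlast
  intro y hy
  exact (cellsCheck_sound ks k₀ hne h y (by rwa [hl])).2 rfl

/-! ## The compiled positive window `[0, 0.3188]` (below the residue zero `a₀ = 0.3194150268…`) -/

/-- Breakpoints (`×10⁻⁵`) of the positive cells after `0`: 18 cells on `[0, 0.3188]`, 12 terms each (greedy
design with the compiled checker, seat folder `diag/thetadesign2.lean`; the cells shrink towards `a₀`, where
`Re Φ_ℂ(iy)` vanishes to first order). [folklore] -/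
def posCells : List ℕ :=
  [3000, 6000, 9000, 12000, 15000, 18000, 21000, 24000, 27000, 29000, 30000, 30700, 31200, 31500, 31700,
    31800, 31850, 31880]

/-- **The kernel accepts the 18 positive cells** (`decide +kernel`: fixed-point interval arithmetic at scale
`2⁴⁸`, no `native_decide`). [folklore] -/
theorem cellsCheck_posCells : cellsCheck true 12 0 posCells = true := by
  decide +kernel

/-- **`Re Φ_ℂ(iy) > 0` for `0 ≤ y ≤ 0.3188`**: the residue `∫₀^∞ H_0 cosh(y·) = (π/2)Φ_ℂ(iy)` of the wide
window is positive below `a₀`. [folklore] -/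
theorem re_tsum_pos_wide {y : ℝ} (h0 : 0 ≤ y) (h1 : y ≤ 3188 / 10000) :
    0 < (∑' n : ℕ, term (n + 1) y).re := by
  refine re_tsum_pos_of_cellsCheck cellsCheck_posCells (kₙ := 31880) rfl y ⟨?_, ?_⟩
  · simpa using h0
  · have : ((31880 : ℕ) : ℝ) / KD = 3188 / 10000 := by norm_num [KD]
    rw [this]; exact h1

end UniversalFactor.PhiICert

end Summit.RiemannHypothesis.RiemannHypothesis.Theorems
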